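import Mathlib
import HarnessLib

/-!
# Shelf crux `EnstrophyQuarterLaw` (stmt-NavierStokesRegularity-1574), line «sparse_sieve»:
# lattice geometry for the dyadic sieve (`stub_sieve`, part 1 of 3)

Theorems helper file (seat ns-hhe-c1 g2; `--supports` the shelf crux). Pure finite-dimensional
geometry and counting in `ℝ³ = EuclideanSpace ℝ (Fin 3)`, no Navier–Stokes content; used by the
dyadic ε-regularity sieve that proves the registered stub `stub_sieve` of
`Cruxes/EnstrophyQuarterLaw/Lines/sparse_sieve.lean`
(`UniformLocalTypeI ∧ UniformSparseness ∧ SmoothingEnvelope ∧ FarFieldEnstrophy ⇒ WindowLaw`).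

The sieve works on the cubic lattices `(s ℤ)³` of spacing `s = R_j / 4`, `R_j = R₀ 2^{-j}`; the
lattice point of index `k : Fin 3 → ℤ` is `(s k₀, s k₁, s k₂)`, written inline as
`WithLp.toLp 2 fun i => s * (k i : ℝ)` (no new definitions are introduced). Contents:

* `abs_sub_apply_le_dist` — a coordinate difference is bounded by the Euclidean distance;
* `dist_lt_of_abs_sub_le` — coordinates within `s/2` ⇒ distance `< s` (`√3/2 < 1`);
* `exists_round_lattice` — rounding: every point has a lattice point with all coordinates within
  `s/2`, hence at distance `< s` (the balls `B(s k, s)`, `k ∈ ℤ³`, cover `ℝ³`);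
* `exists_child_lattice` — a point of a parent ball `B(s' k', s')`, `s' = 2s`, rounds, at spacing `s`, to an
  index `k` with `|kᵢ − 2k'ᵢ| ≤ 2` (so a parent ball has at most `5³ = 125` children);
* `mem_children`, `card_children_le` — the children as a `Finset` image of the `125` offsets;
* `le_dist_lattice_of_modEq` — distinct indices congruent mod `16` componentwise give lattice
  points at distance `≥ 16 s`;
* `card_le_of_separated_subfamilies` — if every `16 s`-separated subfamily of a finite index set
  has at most `N₀` members then the set has at most `16³ N₀ = 4096 N₀` members (pigeonhole over
  the `16³` residue classes);
* `exists_lattice_mem_box` — points of `B(0, ρ)` round to indices in the cube `[-K₀, K₀]³`,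
  `K₀ = ⌈ρ/s⌉₊ + 1`;  `child_mem_box` — children of the cube `[-K, K]³` lie in `[-(2K+2), 2K+2]³`.

HONEST FRAMING: bookkeeping lemmas; nothing here bears on the regularity problem and no summit
statement is proved.
-/

noncomputable section

-- the summit and its single sub-problem share the name (CONVENTIONS §1), as in every Theorems file
set_option linter.dupNamespace false

namespace Summit.NavierStokesRegularity.NavierStokesRegularity.Theorems.EnstrophyQuarterLaw.SparseSieve

open Set Metric Finset

/-! ### Coordinates versus Euclidean distance -/

/-- A coordinate difference is bounded by the Euclidean distance in `ℝ³`. [folklore] -/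
theorem abs_sub_apply_le_dist (x y : EuclideanSpace ℝ (Fin 3)) (i : Fin 3) :
    |x i - y i| ≤ dist x y := by
  rw [dist_eq_norm, ← Real.norm_eq_abs]
  exact PiLp.norm_apply_le (x - y) i

/-- If all three coordinates of `y - p` are at most `s/2` in size then `dist y p < s`
(`√3 / 2 < 1`). [folklore] -/
theorem dist_lt_of_abs_sub_le {s : ℝ} (hs : 0 < s) {y p : EuclideanSpace ℝ (Fin 3)}
    (h : ∀ i, |y i - p i| ≤ s / 2) : dist y p < s := by
  rw [EuclideanSpace.dist_eq, Real.sqrt_lt' hs]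
  calc ∑ i, dist (y i) (p i) ^ 2 ≤ ∑ _i : Fin 3, (s / 2) ^ 2 := by
        refine Finset.sum_le_sum fun i _ => ?_
        rw [Real.dist_eq]
        exact pow_le_pow_left₀ (abs_nonneg _) (h i) 2
    _ = 3 * (s / 2) ^ 2 := by simp
    _ < s ^ 2 := by nlinarith

/-! ### Rounding to the lattice of spacing `s` -/

/-- **Rounding.** Every point of `ℝ³` has a lattice index `k` (spacing `s > 0`) with all
coordinates of `y - s k` at most `s/2`; in particular `dist y (s k) < s`, so the balls
`B(s k, s)`, `k ∈ ℤ³`, cover `ℝ³`. [folklore] -/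
theorem exists_round_lattice {s : ℝ} (hs : 0 < s) (y : EuclideanSpace ℝ (Fin 3)) :
    ∃ k : Fin 3 → ℤ, (∀ i, |y i - s * (k i : ℝ)| ≤ s / 2) ∧
      dist y (WithLp.toLp 2 fun i => s * (k i : ℝ)) < s := by
  refine ⟨fun i => round (y i / s), ?_, ?_⟩
  · intro i
    have e : y i - s * (round (y i / s) : ℝ) = s * (y i / s - round (y i / s)) := by
      rw [mul_sub, mul_div_cancel₀ _ hs.ne']
    rw [e, abs_mul, abs_of_pos hs]
    have := abs_sub_round (y i / s)
    nlinarith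
  · refine dist_lt_of_abs_sub_le hs fun i => ?_
    have e : y i - s * (round (y i / s) : ℝ) = s * (y i / s - round (y i / s)) := by
      rw [mul_sub, mul_div_cancel₀ _ hs.ne']
    show |y i - s * (round (y i / s) : ℝ)| ≤ s / 2
    rw [e, abs_mul, abs_of_pos hs]
    have := abs_sub_round (y i / s)
    nlinarith

/-- **Children.** A point of the parent ball `B(2s k', 2s)` (spacing `2s`) rounds, at spacing
`s`, to an index `k` with `|kᵢ - 2 k'ᵢ| ≤ 2` for all `i` and `dist y (s k) < s`. [folklore] -/
theorem exists_child_lattice {s s' : ℝ} (hs : 0 < s) (hs' : s' = 2 * s) (k' : Fin 3 → ℤ)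
    {y : EuclideanSpace ℝ (Fin 3)}
    (hy : y ∈ ball (WithLp.toLp 2 fun i => s' * (k' i : ℝ) : EuclideanSpace ℝ (Fin 3)) s') :
    ∃ k : Fin 3 → ℤ, (∀ i, |k i - 2 * k' i| ≤ 2) ∧
      dist y (WithLp.toLp 2 fun i => s * (k i : ℝ)) < s := by
  subst hs'
  obtain ⟨k, hk, hdist⟩ := exists_round_lattice hs y
  refine ⟨k, fun i => ?_, hdist⟩
  have h1 : |y i - 2 * s * (k' i : ℝ)| < 2 * s := by
    have := abs_sub_apply_le_dist y (WithLp.toLp 2 fun i => 2 * s * (k' i : ℝ)) i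
    exact lt_of_le_of_lt this (mem_ball.1 hy)
  have h2 : |s * ((k i : ℝ) - 2 * (k' i : ℝ))| < 5 / 2 * s := by
    have e : s * ((k i : ℝ) - 2 * (k' i : ℝ)) = (y i - 2 * s * (k' i : ℝ)) - (y i - s * (k i : ℝ)) := by
      ring
    rw [e]
    refine lt_of_le_of_lt (abs_sub _ _) ?_
    linarith [hk i]
  rw [abs_mul, abs_of_pos hs] at h2
  have h3 : |(k i : ℝ) - 2 * (k' i : ℝ)| < 5 / 2 := by nlinarith
  have h4 : ((|k i - 2 * k' i| : ℤ) : ℝ) < ((3 : ℤ) : ℝ) := by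
    rw [Int.cast_abs]; push_cast; linarith
  have h5 : |k i - 2 * k' i| < 3 := by exact_mod_cast h4
  omega

/-- The child indices of `k'` as a finite set: the image of the `5³` offsets `d ∈ [-2, 2]³` under
`d ↦ 2k' + d`; an index with `|kᵢ - 2k'ᵢ| ≤ 2` belongs to it. [folklore] -/
theorem mem_children {k k' : Fin 3 → ℤ} (h : ∀ i, |k i - 2 * k' i| ≤ 2) :
    k ∈ (Fintype.piFinset fun _ : Fin 3 => Finset.Icc (-2 : ℤ) 2).image
      (fun d : Fin 3 → ℤ => fun i => 2 * k' i + d i) := by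
  refine Finset.mem_image.2 ⟨fun i => k i - 2 * k' i, ?_, ?_⟩
  · refine Fintype.mem_piFinset.2 fun i => Finset.mem_Icc.2 ?_
    exact abs_le.1 (h i)
  · funext i; ring

/-- A parent index has at most `5³ = 125` children. [folklore] -/
theorem card_children_le (k' : Fin 3 → ℤ) :
    ((Fintype.piFinset fun _ : Fin 3 => Finset.Icc (-2 : ℤ) 2).image
      (fun d : Fin 3 → ℤ => fun i => 2 * k' i + d i)).card ≤ 125 := by
  refine Finset.card_image_le.trans ?_
  rw [Fintype.card_piFinset]
  simp

/-! ### Residue classes mod `16` are `16 s`-separated; pigeonhole -/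

/-- Distinct indices that are congruent mod `16` in every coordinate give lattice points at
distance at least `16 s`. [folklore] -/
theorem le_dist_lattice_of_modEq {s : ℝ} (hs : 0 < s) {k k' : Fin 3 → ℤ} (hne : k ≠ k')
    (hmod : ∀ i, ((k i : ℤ) : ZMod 16) = ((k' i : ℤ) : ZMod 16)) :
    16 * s ≤ dist (WithLp.toLp 2 fun i => s * (k i : ℝ) : EuclideanSpace ℝ (Fin 3))
      (WithLp.toLp 2 fun i => s * (k' i : ℝ)) := by
  obtain ⟨i, hi⟩ := Function.ne_iff.1 hne
  have hdvd : (16 : ℤ) ∣ k' i - k i := (ZMod.intCast_eq_intCast_iff_dvd_sub (k i) (k' i) 16).1 (hmod i)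
  have hne' : k' i - k i ≠ 0 := sub_ne_zero.2 (Ne.symm hi)
  have h16 : (16 : ℤ) ≤ |k' i - k i| := Int.le_of_dvd (abs_pos.2 hne') ((dvd_abs _ _).2 hdvd)
  have h16r : (16 : ℝ) ≤ |((k' i : ℝ)) - (k i : ℝ)| := by
    have : ((16 : ℤ) : ℝ) ≤ ((|k' i - k i| : ℤ) : ℝ) := by exact_mod_cast h16
    rw [Int.cast_abs] at this; push_cast at this; linarith
  refine le_trans ?_ (abs_sub_apply_le_dist _ _ i)
  show 16 * s ≤ |s * (k i : ℝ) - s * (k' i : ℝ)|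
  rw [← mul_sub, abs_mul, abs_of_pos hs, abs_sub_comm]
  nlinarith

/-- **Pigeonhole over residue classes.** If every subfamily of the finite index set `S` whose
lattice points (spacing `s`) are pairwise `16 s`-separated has at most `N₀` members, then
`S` has at most `16³ N₀ = 4096 N₀` members: the `16³` residue classes mod `16` partition `S`
into separated subfamilies. [folklore] -/
theorem card_le_of_separated_subfamilies {s : ℝ} (hs : 0 < s) (S : Finset (Fin 3 → ℤ)) (N₀ : ℕ)
    (hS : ∀ F ⊆ S, (∀ k ∈ F, ∀ k' ∈ F, k ≠ k' →
      16 * s ≤ dist (WithLp.toLp 2 fun i => s * (k i : ℝ) : EuclideanSpace ℝ (Fin 3))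
        (WithLp.toLp 2 fun i => s * (k' i : ℝ))) → F.card ≤ N₀) :
    S.card ≤ 4096 * N₀ := by
  classical
  set f : (Fin 3 → ℤ) → (Fin 3 → ZMod 16) := fun k i => ((k i : ℤ) : ZMod 16) with hf
  have h1 : S.card ≤ N₀ * (S.image f).card := by
    refine Finset.card_le_mul_card_image S N₀ fun a _ => ?_
    refine hS _ (Finset.filter_subset _ _) fun k hk k' hk' hne => ?_
    have hk1 : f k = a := (Finset.mem_filter.1 hk).2
    have hk2 : f k' = a := (Finset.mem_filter.1 hk').2
    refine le_dist_lattice_of_modEq hs hne fun i => ?_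
    have := congrFun (hk1.trans hk2.symm) i
    simpa [hf] using this
  have h2 : (S.image f).card ≤ 4096 := by
    have := Finset.card_le_univ (S.image f)
    simpa [Fintype.card_pi] using this
  calc S.card ≤ N₀ * (S.image f).card := h1
    _ ≤ N₀ * 4096 := Nat.mul_le_mul_left _ h2
    _ = 4096 * N₀ := Nat.mul_comm _ _

/-! ### Finite boxes of indices -/

/-- Points of the ball `B(0, ρ)` round (spacing `s`) to indices of the cube `[-K₀, K₀]³`,
`K₀ = ⌈ρ/s⌉₊ + 1`, at distance `< s`. [folklore] -/
theorem exists_lattice_mem_box {s : ℝ} (hs : 0 < s) (ρ : ℝ) {y : EuclideanSpace ℝ (Fin 3)}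
    (hy : y ∈ ball (0 : EuclideanSpace ℝ (Fin 3)) ρ) :
    ∃ k ∈ Fintype.piFinset fun _ : Fin 3 => Finset.Icc (-((⌈ρ / s⌉₊ + 1 : ℕ) : ℤ)) ((⌈ρ / s⌉₊ + 1 : ℕ) : ℤ),
      dist y (WithLp.toLp 2 fun i => s * (k i : ℝ)) < s := by
  obtain ⟨k, hk, hdist⟩ := exists_round_lattice hs y
  refine ⟨k, Fintype.mem_piFinset.2 fun i => Finset.mem_Icc.2 (abs_le.1 ?_), hdist⟩
  have hyρ : ‖y‖ < ρ := by simpa using hy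
  have hyi : |y i| ≤ ‖y‖ := by
    rw [← Real.norm_eq_abs]; exact PiLp.norm_apply_le y i
  have h1 : s * |(k i : ℝ)| ≤ s / 2 + |y i| := by
    have e : s * (k i : ℝ) = y i - (y i - s * (k i : ℝ)) := by ring
    rw [← abs_of_pos hs, ← abs_mul, e]
    refine (abs_sub _ _).trans ?_
    linarith [hk i, abs_of_pos hs]
  have hceil : ρ / s ≤ (⌈ρ / s⌉₊ : ℝ) := Nat.le_ceil _
  have h2 : |(k i : ℝ)| < (⌈ρ / s⌉₊ : ℝ) + 1 := by
    by_contra hcon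
    rw [not_lt] at hcon
    have h3 : s * ((⌈ρ / s⌉₊ : ℝ) + 1) ≤ s * |(k i : ℝ)| := mul_le_mul_of_nonneg_left hcon hs.le
    have h4 : s * (ρ / s) = ρ := mul_div_cancel₀ _ hs.ne'
    nlinarith
  have h5 : ((|k i| : ℤ) : ℝ) < (((⌈ρ / s⌉₊ + 1 : ℕ) : ℤ) : ℝ) := by
    rw [Int.cast_abs]; push_cast; linarith
  exact (Int.cast_lt.1 h5).le

/-- Children of indices of the cube `[-K, K]³` lie in the cube `[-(2K+2), 2K+2]³`. [folklore] -/
theorem child_mem_box {K : ℤ} {k k' : Fin 3 → ℤ}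
    (hk' : k' ∈ Fintype.piFinset fun _ : Fin 3 => Finset.Icc (-K) K)
    (h : ∀ i, |k i - 2 * k' i| ≤ 2) :
    k ∈ Fintype.piFinset fun _ : Fin 3 => Finset.Icc (-(2 * K + 2)) (2 * K + 2) := by
  refine Fintype.mem_piFinset.2 fun i => Finset.mem_Icc.2 ?_
  have h1 := Finset.mem_Icc.1 (Fintype.mem_piFinset.1 hk' i)
  have h2 := abs_le.1 (h i)
  constructor <;> omega

/-- Membership in a children image gives the coordinate bound back. [folklore] -/
theorem abs_sub_le_of_mem_children {k k' : Fin 3 → ℤ}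
    (hk : k ∈ (Fintype.piFinset fun _ : Fin 3 => Finset.Icc (-2 : ℤ) 2).image
      (fun d : Fin 3 → ℤ => fun i => 2 * k' i + d i)) :
    ∀ i, |k i - 2 * k' i| ≤ 2 := by
  obtain ⟨d, hd, rfl⟩ := Finset.mem_image.1 hk
  intro i
  have := Finset.mem_Icc.1 (Fintype.mem_piFinset.1 hd i)
  rw [abs_le]; constructor <;> simp <;> omega

end Summit.NavierStokesRegularity.NavierStokesRegularity.Theorems.EnstrophyQuarterLaw.SparseSieve

end
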